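import Summits.ResolutionOfSingularities.ResolutionOfSingularities.Theorems.PurelyInseparableDim4PureLeafUnitOneTwoOdd
import Summits.ResolutionOfSingularities.ResolutionOfSingularities.Theorems.PurelyInseparableDim4PureLeafUnitUniformCensus
import HarnessLib
import HarnessLib.Audit.Tags

/-!
# Purely inseparable fourfolds — 56 of the 81 unit leaves `x^a(1+x₀)`, `a ∈ {1,2,3}⁴`, are instances of UNIFORM (every-size) plain-game theorems over `𝔽₂` ‖ K; the other 25 are exactly the 23 plain-undecided leaves and the two certificate-only wins 1111, 3111
# (cell res-dim4-pi; brick (δ) «unit leaves», COUNTS bookkeeping) [OURS · counted 0 · a theorem about OUR coordinate-centre frame v4, not about resolution]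

Width seat `res-dim4-p-10` (g6).  Bookkeeping sequel of `…PureLeafUnitUniformCensus` (g5, p728980: 47 leaves) after this generation's
uniform theorems `…PureLeafUnitOddAll` (p729544), `…AtMostOneOdd` (p730172), `…OneTwoOdd`: the nine `a₀ = 1` leaves with TWO odd
partners — 1123 1132 1213 1231 1312 1321 1233 1323 1332, plain A-wins by certificate before (`…PlainOdd1B/1C/1D/1E`) — are now the
smallest members of the every-size family `PureLeafNF.stateWins_unitLeaf_one_of_not_all_odd`.  So:

* `uniformCensus56 = uniformCensus47 ++ uniformTwoOdd9`, `stateWins_uniformCensus56` (every booking);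
* `uniformCensus56_cover`: every census leaf is uniform (56) or plain-undecided (`plainOpen23`) or one of the two certificate-only
  A-wins `1111` (`UnitDivergence.unitLeafRow18`), `3111` (`…PlainOdd3D`) — i.e. the leaves without a uniform theorem are exactly
  «`a₀` odd with ≥ 2 odd partners, except `a₀ = 1` with exactly 2».

Riders: `𝔽₂`-rational replies; PLAIN coordinate game of OUR frame v4 (`StateWins 2`); the count is bookkeeping of OUR census, not a
statement about resolution; nothing here proves F4-C(2,2), `Terminates1h 2 2` or resolution of singularities in dimension ≥ 4 /
characteristic `p`; counted 0; AI kernel work, weaker than expert review. bears_on: LADDER-RESOLUTION:D157-DOOR2 (res-dim4-pi · brick (δ) ·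
unit-leaf row, COUNTS). Supports stmt-ResolutionOfSingularities-16155 (helper).
-/

set_option linter.dupNamespace false

open MvPolynomial

noncomputable section

namespace Summit.ResolutionOfSingularities.ResolutionOfSingularities.Theorems.PIDim4

namespace UnitLeafPlain

open Literature.AlgebraicGeometry.Resolution

/-- The nine `a₀ = 1` census leaves with exactly two odd partner exponents (lexicographic). [folklore] -/
def uniformTwoOdd9 : List (Fin 4 → ℕ) := [
  ![1, 1, 2, 3], ![1, 1, 3, 2], ![1, 2, 1, 3], ![1, 2, 3, 1], ![1, 2, 3, 3], ![1, 3, 1, 2],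
  ![1, 3, 2, 1], ![1, 3, 2, 3], ![1, 3, 3, 2] ]

/-- The 56 census leaves that are instances of uniform theorems: g5's 47 and the nine above. [folklore] -/
def uniformCensus56 : List (Fin 4 → ℕ) := uniformCensus47 ++ uniformTwoOdd9

/-- The list has 56 distinct entries. [folklore] -/
theorem uniformCensus56_length_nodup : uniformCensus56.length = 56 ∧ uniformCensus56.Nodup := by
  decide

/-- It is drawn from g4's census list. [folklore] -/
theorem uniformCensus56_subset : ∀ v ∈ uniformCensus56, v ∈ InScopeWinCert.unitCensus81 := by
  decide

/-- … and is disjoint from the plain-undecided 23. [folklore] -/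
theorem uniformCensus56_disjoint_plainOpen23 : ∀ v ∈ uniformCensus56, v ∉ plainOpen23 := by
  decide

/-- **The partition of the census**: every one of the 81 unit leaves is uniform (56), plain-undecided (23), or one of the two
certificate-only A-wins `1111`, `3111`. [folklore] -/
theorem uniformCensus56_cover : ∀ v ∈ InScopeWinCert.unitCensus81,
    v ∈ uniformCensus56 ∨ v ∈ plainOpen23 ∨ v = ![1, 1, 1, 1] ∨ v = ![3, 1, 1, 1] := by
  decide

/-- The nine two-odd-partner leaves are uniform A-wins (`PureLeafNF.stateWins_unitLeaf_one_of_not_all_odd`), every booking.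
[OURS · counted 0 · ‖ K] [folklore] -/
theorem stateWins_uniformTwoOdd9 : ∀ v ∈ uniformTwoOdd9, ∀ (r : Fin 4 →₀ ℕ) (exc : Finset (Fin 4)),
    StateWins 2 (⟨monomial (Finsupp.equivFunOnFinite.symm v) 1 * (1 + X 0), r, exc⟩ : State (ZMod 2)) := by
  unfold uniformTwoOdd9
  refine List.forall_mem_cons.mpr ⟨fun r exc => ?_, ?_⟩ -- 1123
  · exact PureLeafNF.stateWins_unitLeaf_one_of_not_all_odd ![1, 1, 2, 3] (by decide) (by decide) r exc
  refine List.forall_mem_cons.mpr ⟨fun r exc => ?_, ?_⟩ -- 1132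
  · exact PureLeafNF.stateWins_unitLeaf_one_of_not_all_odd ![1, 1, 3, 2] (by decide) (by decide) r exc
  refine List.forall_mem_cons.mpr ⟨fun r exc => ?_, ?_⟩ -- 1213
  · exact PureLeafNF.stateWins_unitLeaf_one_of_not_all_odd ![1, 2, 1, 3] (by decide) (by decide) r exc
  refine List.forall_mem_cons.mpr ⟨fun r exc => ?_, ?_⟩ -- 1231
  · exact PureLeafNF.stateWins_unitLeaf_one_of_not_all_odd ![1, 2, 3, 1] (by decide) (by decide) r exc
  refine List.forall_mem_cons.mpr ⟨fun r exc => ?_, ?_⟩ -- 1233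
  · exact PureLeafNF.stateWins_unitLeaf_one_of_not_all_odd ![1, 2, 3, 3] (by decide) (by decide) r exc
  refine List.forall_mem_cons.mpr ⟨fun r exc => ?_, ?_⟩ -- 1312
  · exact PureLeafNF.stateWins_unitLeaf_one_of_not_all_odd ![1, 3, 1, 2] (by decide) (by decide) r exc
  refine List.forall_mem_cons.mpr ⟨fun r exc => ?_, ?_⟩ -- 1321
  · exact PureLeafNF.stateWins_unitLeaf_one_of_not_all_odd ![1, 3, 2, 1] (by decide) (by decide) r exc
  refine List.forall_mem_cons.mpr ⟨fun r exc => ?_, ?_⟩ -- 1323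
  · exact PureLeafNF.stateWins_unitLeaf_one_of_not_all_odd ![1, 3, 2, 3] (by decide) (by decide) r exc
  refine List.forall_mem_cons.mpr ⟨fun r exc => ?_, ?_⟩ -- 1332
  · exact PureLeafNF.stateWins_unitLeaf_one_of_not_all_odd ![1, 3, 3, 2] (by decide) (by decide) r exc
  exact List.forall_mem_nil _

/-- **56 unit leaves of the census are instances of UNIFORM plain-game theorems over `𝔽₂`** (every booking). [OURS · counted 0 · ‖ K]
[folklore] -/
theorem stateWins_uniformCensus56 : ∀ v ∈ uniformCensus56, ∀ (r : Fin 4 →₀ ℕ) (exc : Finset (Fin 4)),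
    StateWins 2 (⟨monomial (Finsupp.equivFunOnFinite.symm v) 1 * (1 + X 0), r, exc⟩ : State (ZMod 2)) := by
  intro v hv
  rcases List.mem_append.mp hv with h47 | h9
  · exact stateWins_uniformCensus47 v h47
  · exact stateWins_uniformTwoOdd9 v h9

end UnitLeafPlain

end Summit.ResolutionOfSingularities.ResolutionOfSingularities.Theorems.PIDim4

end
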